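import Literature.Geometry.Lorentzian.CoordRicciWaveGauge
import Literature.Geometry.Lorentzian.CauchyProblemLocalUniquenessReduced
import HarnessLib

/-!
# The reduced vacuum Einstein equations as a universal quasilinear system on the jet space of
# metric components

Support file (everything proved; the only definitions are explicit linear-algebra utilities and the
four universal coefficient functions) for the named fact
`Literature.Geometry.Lorentzian.hawkingEllis_locallyUnique_vacuumDevelopment`. In the
hypothesis `hre` of `hawkingEllis_locallyUnique_vacuumDevelopment_of_reducedEquations`
(`CauchyProblemLocalUniquenessReduced.lean`) the two coordinate metrics must solve *one and the
same* quasilinear diagonal second-order system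
`𝔞(p,u) u_tt − 2 ∑ 𝔟ⁱ(p,u) u_ti − ∑ 𝔊ⁱʲ(p,u) u_ij = 𝔑(p, u, u_t, ∇u)` for `u` with values in the
component space `F = EuclideanSpace ℝ (Fin (n+1) × Fin (n+1))`. This file defines that system from
the wave-gauge form of the Ricci tensor (`CoordRicciWaveGauge.lean`, Hawking–Ellis 1973, §7.5
(7.42)–(7.46)): reading a component vector `u` back as a bilinear form `bilinOfComps u`
(inverse to `bilinComps`), the coefficients are the inverse-metric entries
`𝔞 = −g⁰⁰`, `𝔟ᵏ = g^{0,k+1}`, `𝔊ᵏˡ = g^{k+1,l+1}` (`ReducedEinstein.𝔞/𝔟/𝔊`) and the right-hand side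
is `𝔑 = −2 · ricRem` evaluated on the `1`-jet `(bilinOfComps u, jetT u_t ∇u)` (`ReducedEinstein.𝔑`);
all four are smooth on the open sets of nondegenerate jets (`contDiffOn_𝔞`, …, `contDiffOn_𝔑`),
which are the hypotheses `h𝔞, h𝔟, h𝔊, h𝔊s, h𝔑, hΩ₁, hΩ₂` of `hre`. That the component functions
of a vacuum metric in a wave chart solve this system is proved in a sequel from
`IsMetricOn.ricAt_eq_of_gaugeFun_eq_zero` and `CoordChart.ricAt_metricRepr_eq_zero`.

## References

* S. W. Hawking, G. F. R. Ellis, *The large scale structure of space-time*, CUP 1973, §7.5,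
  (7.42)–(7.46). [HawkingEllis1973CUP]
-/

noncomputable section

set_option maxSynthPendingDepth 3

open Set Filter ContinuousLinearMap Module
open scoped Topology ContDiff

namespace Literature.Geometry.Lorentzian

namespace ReducedEinstein

variable (m : ℕ)

/-- Local abbreviation: `E = ℝᵐ`. [folklore] -/
abbrev Em : Type := EuclideanSpace ℝ (Fin m)

/-- Local abbreviation: the component space `F = ℝ^{m × m}`. [folklore] -/
abbrev Fm : Type := EuclideanSpace ℝ (Fin m × Fin m)

/-- The standard basis of `ℝᵐ`. [folklore] -/
abbrev e : Basis (Fin m) ℝ (Em m) := (EuclideanSpace.basisFun (Fin m) ℝ).toBasis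

variable {m}

/-- `e a = single a 1`. [folklore] -/
theorem e_apply (a : Fin m) : e m a = EuclideanSpace.single a 1 := by
  simp [e]

/-! ### Reading components back as a bilinear form -/

/-- The elementary bilinear form `P_{ab}(v, w) = v_a w_b`. [folklore] -/
def elemBilin (a b : Fin m) : Em m →L[ℝ] Em m →L[ℝ] ℝ :=
  ((ContinuousLinearMap.compL ℝ (Em m) ℝ ℝ).flip (EuclideanSpace.proj b)).comp
    ((ContinuousLinearMap.mul ℝ ℝ).comp (EuclideanSpace.proj a))

/-- `P_{ab}(v, w) = v_a w_b`. [folklore] -/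
@[simp]
theorem elemBilin_apply (a b : Fin m) (v w : Em m) : elemBilin a b v w = v a * w b := rfl

/-- **Components ↦ bilinear form**: `bilinOfComps u = ∑_{ab} u_{ab} P_{ab}`, i.e.
`(bilinOfComps u)(v, w) = ∑ u_{ab} v_a w_b`. [folklore] -/
def bilinOfComps (m : ℕ) : Fm m →L[ℝ] (Em m →L[ℝ] Em m →L[ℝ] ℝ) :=
  ∑ ab : Fin m × Fin m, (EuclideanSpace.proj ab).smulRight (elemBilin ab.1 ab.2)

/-- `(bilinOfComps u)(v, w) = ∑_{ab} u_{ab} v_a w_b`. [folklore] -/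
theorem bilinOfComps_apply (u : Fm m) (v w : Em m) :
    bilinOfComps m u v w = ∑ ab : Fin m × Fin m, u ab * (v ab.1 * w ab.2) := by
  simp [bilinOfComps]

/-- `(bilinOfComps u)(e_a, e_b) = u_{ab}`. [folklore] -/
theorem bilinOfComps_apply_single (u : Fm m) (a b : Fin m) :
    bilinOfComps m u (EuclideanSpace.single a 1) (EuclideanSpace.single b 1) = u (a, b) := by
  classical
  rw [bilinOfComps_apply]
  have h : ∀ ab : Fin m × Fin m, u ab * ((EuclideanSpace.single a (1 : ℝ)) ab.1 *
      (EuclideanSpace.single b (1 : ℝ)) ab.2) = if ab = (a, b) then u (a, b) else 0 := by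
    rintro ⟨a', b'⟩
    simp only [PiLp.single_apply, Prod.mk.injEq]
    by_cases ha : a' = a <;> by_cases hb : b' = b <;> simp [ha, hb]
  rw [Finset.sum_congr rfl fun ab _ ↦ h ab, Finset.sum_ite_eq' Finset.univ (a, b)]
  simp

/-- **`bilinComps ∘ bilinOfComps = id`.** [folklore] -/
theorem bilinComps_bilinOfComps (u : Fm m) : bilinComps m (bilinOfComps m u) = u := by
  refine PiLp.ext fun ab ↦ ?_
  obtain ⟨a, b⟩ := ab
  rw [bilinComps_apply, bilinOfComps_apply_single]

/-- A bilinear form on `ℝᵐ` expanded in coordinates: `B(v, w) = ∑_{ab} B(e_a, e_b) v_a w_b`.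
[folklore] -/
theorem bilin_apply_eq_sum (B : Em m →L[ℝ] Em m →L[ℝ] ℝ) (v w : Em m) :
    B v w = ∑ ab : Fin m × Fin m,
      B (EuclideanSpace.single ab.1 1) (EuclideanSpace.single ab.2 1) * (v ab.1 * w ab.2) := by
  have hv : v = ∑ a, v a • EuclideanSpace.single a (1 : ℝ) := by
    simpa using ((EuclideanSpace.basisFun (Fin m) ℝ).sum_repr v).symm
  have hw : w = ∑ b, w b • EuclideanSpace.single b (1 : ℝ) := by
    simpa using ((EuclideanSpace.basisFun (Fin m) ℝ).sum_repr w).symm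
  conv_lhs => rw [hv, hw]
  simp only [map_sum, map_smul, FunLike.coe_sum, Finset.sum_apply, _root_.smul_apply,
    smul_eq_mul, Finset.mul_sum]
  rw [Fintype.sum_prod_type, Finset.sum_comm]
  exact Finset.sum_congr rfl fun a _ ↦ Finset.sum_congr rfl fun b _ ↦ by ring

/-- **`bilinOfComps ∘ bilinComps = id`.** [folklore] -/
theorem bilinOfComps_bilinComps (B : Em m →L[ℝ] Em m →L[ℝ] ℝ) :
    bilinOfComps m (bilinComps m B) = B := by
  ext v w
  rw [bilinOfComps_apply, bilin_apply_eq_sum B v w]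
  exact Finset.sum_congr rfl fun ab _ ↦ by rw [bilinComps_apply]

/-! ### Reading the first derivatives back as a trilinear form -/

/-- **The `1`-jet as a trilinear form**: from the time-derivative components `v` and the spatial
derivative components `X k` build `T` with `T(w) = ∑ᵢ wᵢ Bᵢ`, `B₀ = bilinOfComps v`,
`B_{k+1} = bilinOfComps (X k)`. [folklore] -/
def jetT (n : ℕ) : Fm (n + 1) × (Fin n → Fm (n + 1)) →L[ℝ]
    (Em (n + 1) →L[ℝ] Em (n + 1) →L[ℝ] Em (n + 1) →L[ℝ] ℝ) :=
  ∑ i : Fin (n + 1),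
    (ContinuousLinearMap.smulRightL ℝ (Em (n + 1)) (Em (n + 1) →L[ℝ] Em (n + 1) →L[ℝ] ℝ)
        (EuclideanSpace.proj i)).comp
      (Fin.cases ((bilinOfComps (n + 1)).comp (ContinuousLinearMap.fst ℝ _ _))
        (fun k ↦ (bilinOfComps (n + 1)).comp
          ((ContinuousLinearMap.proj k).comp (ContinuousLinearMap.snd ℝ _ _))) i)

/-- The bilinear forms `Bᵢ` of a jet: `B₀ = bilinOfComps v`, `B_{k+1} = bilinOfComps (X k)`. [folklore] -/
def jetB {n : ℕ} (vX : Fm (n + 1) × (Fin n → Fm (n + 1))) (i : Fin (n + 1)) :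
    Em (n + 1) →L[ℝ] Em (n + 1) →L[ℝ] ℝ :=
  Fin.cases (bilinOfComps (n + 1) vX.1) (fun k ↦ bilinOfComps (n + 1) (vX.2 k)) i

/-- `B₀ = bilinOfComps v`. [folklore] -/
@[simp] theorem jetB_zero {n : ℕ} (vX : Fm (n + 1) × (Fin n → Fm (n + 1))) :
    jetB vX 0 = bilinOfComps (n + 1) vX.1 := rfl

/-- `B_{k+1} = bilinOfComps (X k)`. [folklore] -/
@[simp] theorem jetB_succ {n : ℕ} (vX : Fm (n + 1) × (Fin n → Fm (n + 1))) (k : Fin n) :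
    jetB vX k.succ = bilinOfComps (n + 1) (vX.2 k) := rfl

/-- `jetT (v, X) w = ∑ᵢ wᵢ Bᵢ`. [folklore] -/
theorem jetT_apply {n : ℕ} (vX : Fm (n + 1) × (Fin n → Fm (n + 1))) (w : Em (n + 1)) :
    jetT n vX w = ∑ i, w i • jetB vX i := by
  simp only [jetT, FunLike.coe_sum, Finset.sum_apply, ContinuousLinearMap.comp_apply]
  refine Finset.sum_congr rfl fun i _ ↦ ?_
  cases i using Fin.cases <;> rfl

/-- `jetT (v, X) eᵢ = Bᵢ`. [folklore] -/
theorem jetT_apply_single {n : ℕ} (vX : Fm (n + 1) × (Fin n → Fm (n + 1))) (i : Fin (n + 1)) :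
    jetT n vX (EuclideanSpace.single i 1) = jetB vX i := by
  classical
  rw [jetT_apply]
  have h : ∀ j, (EuclideanSpace.single i (1 : ℝ)) j • jetB vX j = if j = i then jetB vX i else 0 := by
    intro j
    simp only [PiLp.single_apply]
    by_cases hj : j = i
    · subst hj; simp
    · simp [hj]
  rw [Finset.sum_congr rfl fun j _ ↦ h j, Finset.sum_ite_eq' Finset.univ i]
  simp

/-- **Reconstruction of a trilinear form from the components of its values on the basis.**
[folklore] -/
theorem jetT_bilinComps {n : ℕ} (T : Em (n + 1) →L[ℝ] Em (n + 1) →L[ℝ] Em (n + 1) →L[ℝ] ℝ) :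
    jetT n (bilinComps (n + 1) (T (EuclideanSpace.single 0 1)),
      fun k ↦ bilinComps (n + 1) (T (EuclideanSpace.single k.succ 1))) = T := by
  have hB : ∀ i, jetB (bilinComps (n + 1) (T (EuclideanSpace.single 0 1)),
      fun k ↦ bilinComps (n + 1) (T (EuclideanSpace.single k.succ 1))) i =
      T (EuclideanSpace.single i 1) := by
    refine Fin.cases ?_ (fun k ↦ ?_)
    · rw [jetB_zero, bilinOfComps_bilinComps]
    · rw [jetB_succ, bilinOfComps_bilinComps]
  ext w v u
  rw [jetT_apply]
  simp only [hB]
  have hw : w = ∑ i, w i • EuclideanSpace.single i (1 : ℝ) := by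
    simpa using ((EuclideanSpace.basisFun (Fin (n + 1)) ℝ).sum_repr w).symm
  conv_rhs => rw [hw]
  simp only [map_sum, map_smul, FunLike.coe_sum, Finset.sum_apply, _root_.smul_apply]

/-! ### The universal coefficient functions -/

variable (n : ℕ)

/-- Points of `ℝ × ℝⁿ` (the split coordinates). [folklore] -/
abbrev Pt : Type := ℝ × EuclideanSpace ℝ (Fin n)

/-- `𝔞(p, u) = −g⁰⁰(u)`: the coefficient of `u_tt` in the reduced Einstein operator. [cite: HawkingEllis1973CUP, §7.5 (7.46)] -/
def 𝔞 (qu : Pt n × Fm (n + 1)) : ℝ :=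
  -MetricCoord.ginvOf (e (n + 1)) (bilinOfComps (n + 1) qu.2) 0 0

/-- `𝔟ᵏ(p, u) = g^{0,k+1}(u)`: the coefficients of `u_{t x_k}`. [cite: HawkingEllis1973CUP, §7.5 (7.46)] -/
def 𝔟 (k : Fin n) (qu : Pt n × Fm (n + 1)) : ℝ :=
  MetricCoord.ginvOf (e (n + 1)) (bilinOfComps (n + 1) qu.2) 0 k.succ

/-- `𝔊ᵏˡ(p, u) = g^{k+1,l+1}(u)`: the coefficients of `u_{x_k x_l}`. [cite: HawkingEllis1973CUP, §7.5 (7.46)] -/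
def 𝔊 (k l : Fin n) (qu : Pt n × Fm (n + 1)) : ℝ :=
  MetricCoord.ginvOf (e (n + 1)) (bilinOfComps (n + 1) qu.2) k.succ l.succ

/-- `𝔑(p, u, u_t, ∇u) = −2 ricRem`: the right-hand side of the reduced vacuum Einstein equations
`𝔞 u_tt − 2 ∑ 𝔟ᵏ u_{t k} − ∑ 𝔊ᵏˡ u_{kl} = 𝔑`, componentwise. [cite: HawkingEllis1973CUP, §7.5 (7.45)–(7.46)] -/
def 𝔑 (J : Pt n × Fm (n + 1) × Fm (n + 1) × (Fin n → Fm (n + 1))) : Fm (n + 1) :=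
  (EuclideanSpace.equiv (Fin (n + 1) × Fin (n + 1)) ℝ).symm fun ab ↦
    -2 * MetricCoord.ricRem (e (n + 1)) (bilinOfComps (n + 1) J.2.1) (jetT n (J.2.2.1, J.2.2.2))
      (EuclideanSpace.single ab.1 1) (EuclideanSpace.single ab.2 1)

/-- The open set of nondegenerate `0`-jets. [folklore] -/
def Ω₁ : Set (Pt n × Fm (n + 1)) :=
  {qu | (bilinOfComps (n + 1) qu.2).IsInvertible}

/-- The open set of nondegenerate `1`-jets. [folklore] -/
def Ω₂ : Set (Pt n × Fm (n + 1) × Fm (n + 1) × (Fin n → Fm (n + 1))) :=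
  {J | (bilinOfComps (n + 1) J.2.1).IsInvertible}

variable {n}

/-- `𝔑` componentwise. [folklore] -/
theorem 𝔑_apply (J : Pt n × Fm (n + 1) × Fm (n + 1) × (Fin n → Fm (n + 1))) (a b : Fin (n + 1)) :
    𝔑 n J (a, b) = -2 * MetricCoord.ricRem (e (n + 1)) (bilinOfComps (n + 1) J.2.1)
      (jetT n (J.2.2.1, J.2.2.2)) (EuclideanSpace.single a 1) (EuclideanSpace.single b 1) := rfl

/-- The set of invertible continuous linear maps between Banach spaces is open. [folklore] -/
theorem isOpen_setOf_isInvertible {V W : Type*} [NormedAddCommGroup V] [NormedSpace ℝ V]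
    [CompleteSpace V] [NormedAddCommGroup W] [NormedSpace ℝ W] [CompleteSpace W] :
    IsOpen {f : V →L[ℝ] W | f.IsInvertible} := by
  have : {f : V →L[ℝ] W | f.IsInvertible} = Set.range ((↑) : (V ≃L[ℝ] W) → (V →L[ℝ] W)) := by
    ext f; simp [ContinuousLinearMap.IsInvertible, eq_comm]
  rw [this]
  exact ContinuousLinearEquiv.isOpen

/-- `Ω₁` is open. [folklore] -/
theorem isOpen_Ω₁ : IsOpen (Ω₁ n) :=
  isOpen_setOf_isInvertible.preimage ((bilinOfComps (n + 1)).continuous.comp continuous_snd)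

/-- `Ω₂` is open. [folklore] -/
theorem isOpen_Ω₂ : IsOpen (Ω₂ n) :=
  isOpen_setOf_isInvertible.preimage
    ((bilinOfComps (n + 1)).continuous.comp (continuous_fst.comp continuous_snd))

/-- The inverse-metric entries are smooth on `Ω₁`. [folklore] -/
theorem contDiffOn_ginvOf_bilinOfComps (i j : Fin (n + 1)) :
    ContDiffOn ℝ ∞ (fun qu : Pt n × Fm (n + 1) ↦
      MetricCoord.ginvOf (e (n + 1)) (bilinOfComps (n + 1) qu.2) i j) (Ω₁ n) := fun qu hqu ↦ by
  have hL : ContDiff ℝ ∞ (fun qu : Pt n × Fm (n + 1) ↦ ((bilinOfComps (n + 1) qu.2,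
      (0 : Em (n + 1) →L[ℝ] Em (n + 1) →L[ℝ] Em (n + 1) →L[ℝ] ℝ)) :
        (Em (n + 1) →L[ℝ] Em (n + 1) →L[ℝ] ℝ) × (Em (n + 1) →L[ℝ] Em (n + 1) →L[ℝ] Em (n + 1) →L[ℝ] ℝ))) :=
    ((bilinOfComps (n + 1)).contDiff.comp contDiff_snd).prodMk contDiff_const
  have hqu' : (bilinOfComps (n + 1) qu.2).IsInvertible := hqu
  have h0 := (MetricCoord.contDiffAt_ginvOf (e (n + 1)) hqu' 0 i j).comp qu hL.contDiffAt
  exact h0.contDiffWithinAt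

/-- `𝔞` is smooth on `Ω₁`. [folklore] -/
theorem contDiffOn_𝔞 : ContDiffOn ℝ ∞ (𝔞 n) (Ω₁ n) :=
  (contDiffOn_ginvOf_bilinOfComps 0 0).neg

/-- `𝔟ᵏ` is smooth on `Ω₁`. [folklore] -/
theorem contDiffOn_𝔟 (k : Fin n) : ContDiffOn ℝ ∞ (𝔟 n k) (Ω₁ n) :=
  contDiffOn_ginvOf_bilinOfComps 0 k.succ

/-- `𝔊ᵏˡ` is smooth on `Ω₁`. [folklore] -/
theorem contDiffOn_𝔊 (k l : Fin n) : ContDiffOn ℝ ∞ (𝔊 n k l) (Ω₁ n) :=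
  contDiffOn_ginvOf_bilinOfComps k.succ l.succ

/-- `𝔑` is smooth on `Ω₂`. [folklore] -/
theorem contDiffOn_𝔑 : ContDiffOn ℝ ∞ (𝔑 n) (Ω₂ n) := fun J hJ ↦ by
  have hL : ContDiff ℝ ∞ (fun J : Pt n × Fm (n + 1) × Fm (n + 1) × (Fin n → Fm (n + 1)) ↦
      ((bilinOfComps (n + 1) J.2.1, jetT n (J.2.2.1, J.2.2.2)) :
        (Em (n + 1) →L[ℝ] Em (n + 1) →L[ℝ] ℝ) × (Em (n + 1) →L[ℝ] Em (n + 1) →L[ℝ] Em (n + 1) →L[ℝ] ℝ))) :=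
    ((bilinOfComps (n + 1)).contDiff.comp (contDiff_fst.comp contDiff_snd)).prodMk
      ((jetT n).contDiff.comp (contDiff_snd.comp contDiff_snd))
  have hc : ∀ a b : Fin (n + 1), ContDiffAt ℝ ∞
      (fun J : Pt n × Fm (n + 1) × Fm (n + 1) × (Fin n → Fm (n + 1)) ↦
        -2 * MetricCoord.ricRem (e (n + 1)) (bilinOfComps (n + 1) J.2.1) (jetT n (J.2.2.1, J.2.2.2))
          (EuclideanSpace.single a 1) (EuclideanSpace.single b 1)) J := fun a b ↦ by
    have hJ' : (bilinOfComps (n + 1) J.2.1).IsInvertible := hJ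
    have h0 := (MetricCoord.contDiffAt_ricRem (e (n + 1)) hJ' (jetT n (J.2.2.1, J.2.2.2))
        (EuclideanSpace.single a 1) (EuclideanSpace.single b 1)).comp J hL.contDiffAt
    have h1 : ContDiffAt ℝ ∞
        (fun J : Pt n × Fm (n + 1) × Fm (n + 1) × (Fin n → Fm (n + 1)) ↦
          MetricCoord.ricRem (e (n + 1)) (bilinOfComps (n + 1) J.2.1) (jetT n (J.2.2.1, J.2.2.2))
            (EuclideanSpace.single a 1) (EuclideanSpace.single b 1)) J := h0
    exact contDiffAt_const.mul h1
  refine ContDiffAt.contDiffWithinAt ?_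
  exact (contDiffAt_euclidean (f := 𝔑 n) (y := J)).2 fun ab ↦ hc ab.1 ab.2

end ReducedEinstein

end Literature.Geometry.Lorentzian
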